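import Literature.AlgebraicGeometry.Resolution.PointBlowupMohBoundPrimePower
import Literature.AlgebraicGeometry.Resolution.PointBlowupMohStability
import Literature.AlgebraicGeometry.Resolution.PointBlowupNoConsecutiveJumps
import Mathlib.Algebra.MvPolynomial.Equiv
import Mathlib.Algebra.Ring.GeomSum
import HarnessLib

/-!
# Moh's witness at order `pᵉ`: a non-exceptional `q`-witness forbids an increase of the shade, in every chart and every dimension

Topic: `Literature/AlgebraicGeometry/Resolution`. Companion (cell `pub-hironaka`, unit
`b2b-hironaka-cp4`, DIM-4 CENSUS gen 15) of

* `PointBlowupMohStability.lean` (gen 12), §§2–3: at order `p` (`e = 1`), Moh's "`X`-kind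
  variable" — a NON-exceptional variable `y_{i₀}` (`r_{i₀} = 0`) carrying an initial exponent
  prime to `p` — forbids an increase of the shade at every point of every chart
  (`shade_step_le_of_witness`); the chart `j = i₀` needed a new probe, the relative Euler
  operator `o·G − Σ_{i ≠ j} (y_i + b_i) ∂_i G` (`exists_support_step_of_not_dvd_self`);
* `PointBlowupMohBoundPrimePower.lean` (gen 14): at order `q = pᵉ`, the Hasse probe
  `D^{(p^k e_{i₀})}` gives the same conclusion for a witness index `i₀ ≠ j` which is untranslated
  or non-exceptional (`shade_step_le_of_choose_ne_zero`), whence the necessary conditions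
  `necessary_of_shadeIncreases_pow` — whose clause (ii) is stated for the indices `i ≠ j` only:
  the Hasse derivative in the direction of the CHART variable `y_j` does not survive the chart
  substitution.

This file supplies the missing chart `j = i₀` at order `q = pᵉ`, for every `e` and every number of
variables, in the model of `PointBlowupShade.lean` (fixed coordinates subordinate to the
exceptional divisor, point blow-ups, cleaning by deletion of the `q`-th power monomials):

* `PointBlowup.exists_support_step_of_not_pow_dvd_self`, `PointBlowup.shade_step_le_of_not_pow_dvd_self`:
  if `r_j = 0` and some initial monomial of `F` has `q ∤ d_j`, then at every point `b` of the
  `y_j`-chart the new residual polynomial has a monomial in its lowest `y_j`-layer, surviving the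
  cleaning, of degree `≤ |r′| + shade`; so the shade does not increase;
* `PointBlowup.shade_step_le_of_pow_witness`, `PointBlowup.not_shadeIncreases_of_pow_witness`:
  a `q`-WITNESS (a non-exceptional variable with an initial exponent not divisible by `q`) forbids
  an increase at every point of every chart;
* `PointBlowup.exists_support_step_of_not_pow_dvd_self'`: the same with the dichotomy of the
  `e = 1` template — EITHER a strict drop OR a translated index `i ≠ j` (`b_i ≠ 0`) with
  `q ∤ E_i` (the translation budget, `degree_le_of_coeff_scale_monomial_of_flat`);
* `PointBlowup.exists_pow_witness_step_of_shade_eq` (§5): a `q`-witness PERSISTS under a stall, at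
  every point of every chart; hence `PointBlowup.shade_eq_and_pow_witness_of_not_drop`,
  `PointBlowup.exists_drop_of_shade_lt_of_pow_witness`: from a state with a `q`-witness, along any
  sequence of point blow-ups with order `≥ q`, the shade does not increase before it has dropped;
  and, with `exists_initial_lowestLayer_of_pow_dvd` (`PointBlowupNoConsecutiveJumps.lean`),
  `PointBlowup.exists_drop_of_shade_lt_after_jump_of_pow_dvd`: after a jump onto an order
  divisible by `q` the shade does not increase again before a strict drop ("increase, stalls,
  increase" is impossible in that case) — the part of Moh's stability claim that holds at every `e`;
* `PointBlowup.pow_dvd_apply_of_shadeIncreases_of_nonexceptional`: contrapositive — if the shade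
  increases, EVERY non-exceptional variable, the chart variable included, occurs in the initial
  form of `F` only with exponents divisible by `q`. In print this is Hauser–Perlega's assertion
  (7) of their Theorem ("For `j ∉ T`, the variables `x_j` appear only as `pᵉ`-th powers in
  `F(x)`", [HauserPerlega2019PRIMS] §3), proved there in coordinates NORMALISED to the blow-up
  (§2: "either `T = {1}` or … for all indices `i ∈ T` the inclusion `V(x_i) ⊂ D` holds", i.e. a
  non-exceptional chart variable only occurs at the origin of its chart); the condition
  "`In(F) ∈ K[y_A][y₁^q, …, y_n^q]`" (`A` the exceptional indices) being stable under the
  coordinate changes subordinate to `D` (`(y_k + λy_j)^q = y_k^q + λ^q y_j^q`), the printed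
  statement covers the fixed-coordinate one after a change of chart and of coordinates; the tree,
  whose states live in fixed coordinates, needed a direct proof, given here.

## Method: the Hasse–Euler probe, realised in `K[t, y]`

The weight wanted on an initial monomial `y^d` (`|d| = o`) is the `k`-th `p`-adic digit of `d_j`,
`(d_j choose p^k)`, for a digit `k < e` of the witness exponent `(d₀)_j` which is non-zero
(`exists_natCast_choose_prime_pow_ne_zero`): it vanishes unless `d_j ≥ p^k`, which places the
lowest `y_j`-layer of the probe polynomial `p^k` below the critical degree (§4, as in the `e = 1`
template where the weight is `d_j` itself). An operator with this eigenvalue on the chart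
monomials `(y + b)^{d^}` (`Σ_{i ≠ j} d^_i = o − d_j`) is
`[t^a] (1 + t)^o · Φ_v`, `a = p^k`, where `Φ_v` scales the translated coordinates `y_i + b_i`
(`i ≠ j`) by `1 + v(t)`, `v(t) = −t + t² − ⋯ ± t^a` the inverse of `1 + t` truncated at order `a`
(`scale_translate_monomial`, `coeff_weight_eq_choose`; for `v = t` one gets the total Hasse–Euler
operators `Σ_{|α| = a} (y + b)^α ∂^{(α)}` with eigenvalues `(o − d_j choose a)`, which do not
separate the layer). Everything is computed in the auxiliary polynomial ring
`K[t, y] = MvPolynomial (Option σ) K` through three support properties of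
`(1 + t)^o · Φ_v(c·y^μ)` propagated through products (§1): its monomials `t^a y^β` have
`β_j = μ_j`, `|β| + a ≥ |μ|` (`v(0) = 0`), and — when `q ∣ μ_i` for all `i ≠ j` and `q ∣ o` —
`q ∣ a` (Frobenius), §3; a fourth, graded by `|β| + q⌊a/q⌋`, gives `|β| ≥ |μ|` when the
translated exponents of `μ` are `q`-divisible (the translation budget). No multinomial identity and
no explicit formula for the operator is needed; the coefficient extraction `[t^a y^β]` goes through
`MvPolynomial.optionEquivLeft` (§2).

## What is NOT proved here

After a jump onto an order NOT divisible by `q` no `q`-witness need exist (only the next step is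
controlled, by Probe 1), and after a DROP the witness may be lost: so nothing here bounds the
shade along a whole sequence. Moh's claim `shade ≤ shade₀ + p^{e−1}` along sequences remains
refuted for `e ≥ 3` (Hauser–Perlega, `mohStabilityClaim_false`) and open in print for `e = 2`
(`PointBlowupNoConsecutiveJumps.lean`, module docstring); the `e = 1` theorem
`shade_le_shade_add_one_along` is not re-derived.

## References

* [Moh87] T. T. Moh, *On a stability theorem for local uniformization in characteristic p*,
  Publ. RIMS 23 (1987) 965–973, §1 (p. 972: the `X`-kind variable `x_s`, cases (1)–(2)).
* [HauserPerlega2019PRIMS] H. Hauser, S. Perlega, *Characterizing the increase of the residual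
  order under blowup in positive characteristic*, Publ. RIMS 55 (2019) 835–857, §2 (subordinate
  and normalised coordinates), §3 Theorem (7) and its proof in §5 (`∂_{x_i^{p^k}}(F) = 0` for
  `i ∉ A`, `p^k < q`).
* [Hauser2010] H. Hauser, *On the problem of resolution of singularities in positive
  characteristic*, Bull. AMS 47 (2010), §F (Moh's bound), §G (kangaroo points).

AI-assisted formalisation (pub-hironaka cell); the informal gloss above is the cell's reading of
the cited pages, the Lean statements are what is certified.
-/

open MvPolynomial Finset

open scoped BigOperators Pointwise

namespace Literature.AlgebraicGeometry.Resolution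

open Literature.AlgebraicGeometry.Resolution.Hauser2010

namespace PointBlowup

/-! ## 1. Support calculus: exponent predicates propagated through products and sums -/

section SupportCalculus

variable {τ : Type*} {R : Type*} [CommSemiring R] [DecidableEq τ]

/-- A monomial of a product is a sum of monomials of the factors: graded predicates on exponents
propagate through products. [folklore] -/
theorem forall_support_mul {P Q S : (τ →₀ ℕ) → Prop} (h : ∀ a c, P a → Q c → S (a + c))
    {f g : MvPolynomial τ R} (hf : ∀ m ∈ f.support, P m) (hg : ∀ m ∈ g.support, Q m) :
    ∀ m ∈ (f * g).support, S m := by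
  intro m hm
  obtain ⟨a, ha, c, hc, rfl⟩ := Finset.mem_add.mp (support_mul f g hm)
  exact h a c (hf a ha) (hg c hc)

omit [DecidableEq τ] in
/-- The support of a monomial. [folklore] -/
theorem forall_support_monomial {P : (τ →₀ ℕ) → Prop} {s : τ →₀ ℕ} (hs : P s) (c : R) :
    ∀ m ∈ (monomial s c).support, P m := by
  intro m hm
  have := support_monomial_subset hm
  rw [Finset.mem_singleton] at this
  subst this
  exact hs

omit [DecidableEq τ] in
/-- The support of a constant. [folklore] -/
theorem forall_support_C {P : (τ →₀ ℕ) → Prop} (h0 : P 0) (c : R) :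
    ∀ m ∈ (C c : MvPolynomial τ R).support, P m := by
  rw [C_apply]
  exact forall_support_monomial h0 c

omit [DecidableEq τ] in
/-- The support of `1`. [folklore] -/
theorem forall_support_one {P : (τ →₀ ℕ) → Prop} (h0 : P 0) :
    ∀ m ∈ (1 : MvPolynomial τ R).support, P m := by
  rw [← C_1]
  exact forall_support_C h0 1

omit [DecidableEq τ] in
/-- The support of a power of a variable. [folklore] -/
theorem forall_support_X_pow {P : (τ →₀ ℕ) → Prop} {i : τ} {n : ℕ} (h : P (Finsupp.single i n)) :
    ∀ m ∈ (X i ^ n : MvPolynomial τ R).support, P m := by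
  rw [X_pow_eq_monomial]
  exact forall_support_monomial h 1

omit [DecidableEq τ] in
/-- The support of a variable. [folklore] -/
theorem forall_support_X {P : (τ →₀ ℕ) → Prop} {i : τ} (h : P (Finsupp.single i 1)) :
    ∀ m ∈ (X i : MvPolynomial τ R).support, P m := by
  rw [← pow_one (X i : MvPolynomial τ R)]
  exact forall_support_X_pow h

/-- Predicates on exponents propagate through sums. [folklore] -/
theorem forall_support_add {P : (τ →₀ ℕ) → Prop} {f g : MvPolynomial τ R}
    (hf : ∀ m ∈ f.support, P m) (hg : ∀ m ∈ g.support, P m) :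
    ∀ m ∈ (f + g).support, P m := by
  intro m hm
  rcases Finset.mem_union.mp (support_add hm) with h | h
  exacts [hf m h, hg m h]

/-- Predicates on exponents propagate through finite sums. [folklore] -/
theorem forall_support_sum {ι : Type*} {P : (τ →₀ ℕ) → Prop} (s : Finset ι)
    (f : ι → MvPolynomial τ R) (hf : ∀ x ∈ s, ∀ m ∈ (f x).support, P m) :
    ∀ m ∈ (∑ x ∈ s, f x).support, P m := by
  induction s using Finset.cons_induction with
  | empty =>
    intro m hm
    rw [Finset.sum_empty, support_zero] at hm
    exact absurd hm (Finset.notMem_empty m)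
  | cons x s hx ih =>
    rw [Finset.sum_cons]
    exact forall_support_add (hf x (Finset.mem_cons_self x s))
      (ih fun y hy => hf y (Finset.mem_cons_of_mem hy))

/-- Graded predicates on exponents propagate through powers. [folklore] -/
theorem forall_support_pow {P : ℕ → (τ →₀ ℕ) → Prop} (h0 : P 0 0)
    (hadd : ∀ n₁ n₂ a c, P n₁ a → P n₂ c → P (n₁ + n₂) (a + c))
    {f : MvPolynomial τ R} {n : ℕ} (hf : ∀ m ∈ f.support, P n m) (k : ℕ) :
    ∀ m ∈ (f ^ k).support, P (k * n) m := by
  induction k with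
  | zero =>
    rw [pow_zero, zero_mul]
    exact forall_support_one h0
  | succ k ih =>
    rw [pow_succ, Nat.succ_mul]
    exact forall_support_mul (hadd _ _) ih hf

/-- Graded predicates on exponents propagate through finite products. [folklore] -/
theorem forall_support_prod {ι : Type*} {P : ℕ → (τ →₀ ℕ) → Prop} (h0 : P 0 0)
    (hadd : ∀ n₁ n₂ a c, P n₁ a → P n₂ c → P (n₁ + n₂) (a + c))
    (s : Finset ι) (f : ι → MvPolynomial τ R) (n : ι → ℕ)
    (hf : ∀ x ∈ s, ∀ m ∈ (f x).support, P (n x) m) :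
    ∀ m ∈ (∏ x ∈ s, f x).support, P (∑ x ∈ s, n x) m := by
  induction s using Finset.cons_induction with
  | empty =>
    rw [Finset.prod_empty, Finset.sum_empty]
    exact forall_support_one h0
  | cons x s hx ih =>
    rw [Finset.prod_cons, Finset.sum_cons]
    exact forall_support_mul (hadd _ _) (hf x (Finset.mem_cons_self x s))
      (ih fun y hy => hf y (Finset.mem_cons_of_mem hy))

end SupportCalculus

section Frobenius

variable {τ : Type*} {R : Type*} [CommRing R] (p : ℕ) [hp : Fact p.Prime] [CharP R p]

/-- **Frobenius on supports**: in characteristic `p`, every exponent of every monomial of `f^{pᵉ}`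
is divisible by `pᵉ` (`(Σ c_m y^m)^{q} = Σ c_m^q y^{q m}`). [folklore] -/
theorem forall_support_pow_char_pow (e : ℕ) (f : MvPolynomial τ R) :
    ∀ m ∈ (f ^ p ^ e).support, ∀ x, p ^ e ∣ m x := by
  classical
  rw [f.as_sum, sum_pow_char_pow]
  refine forall_support_sum _ _ fun s _ => ?_
  rw [monomial_pow]
  refine forall_support_monomial (fun x => ?_) _
  rw [Finsupp.smul_apply, smul_eq_mul]
  exact Dvd.intro _ rfl

/-- **Frobenius on supports, exact form**: in characteristic `p`, every monomial of `f^{pᵉ}` is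
`pᵉ • m` for a monomial `m` of `f`. [folklore] -/
theorem exists_smul_of_mem_support_pow_char_pow (e : ℕ) (f : MvPolynomial τ R) :
    ∀ m ∈ (f ^ p ^ e).support, ∃ m' ∈ f.support, m = p ^ e • m' := by
  classical
  intro m hm
  rw [f.as_sum, sum_pow_char_pow] at hm
  refine forall_support_sum (P := fun m => ∃ m' ∈ f.support, m = p ^ e • m') _ _
    (fun s hs => ?_) m hm
  rw [monomial_pow]
  exact forall_support_monomial ⟨s, hs, rfl⟩ _

end Frobenius

/-! ## 2. The auxiliary ring `K[t][y]`: coefficient extraction and the scaling substitution -/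

section Scaling

variable {σ : Type*} {K : Type*} [Field K] [Fintype σ] [DecidableEq σ]

omit [Fintype σ] [DecidableEq σ] in
/-- **Coefficient extraction.** In `K[t, y] = MvPolynomial (Option σ) K` (`t = X none`,
`y_i = X (some i)`): the coefficient of `t^a y^β` in `A(t) · T(y)` is `[t^a]A · [y^β]T`. [folklore] -/
theorem coeff_optionElim_aeval_mul_rename (A : Polynomial K) (T : MvPolynomial σ K)
    (β : σ →₀ ℕ) (a : ℕ) :
    coeff (β.optionElim a)
        (Polynomial.aeval (X none : MvPolynomial (Option σ) K) A * rename some T) =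
      A.coeff a * coeff β T := by
  rw [← optionEquivLeft_coeff_coeff (R := K), map_mul]
  have h1 : optionEquivLeft K σ (Polynomial.aeval (X none : MvPolynomial (Option σ) K) A) =
      A.map (algebraMap K (MvPolynomial σ K)) := by
    rw [← Polynomial.aeval_X_left_eq_map, ← optionEquivLeft_X_none (R := K) (S₁ := σ)]
    exact (Polynomial.aeval_algHom_apply (optionEquivLeft K σ) (X none) A).symm
  have h2 : optionEquivLeft K σ (rename some T) = Polynomial.C T := by
    have := (optionEquivLeft K σ).apply_symm_apply (Polynomial.C T)
    rwa [optionEquivLeft_symm_apply, Polynomial.aevalTower_C] at this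
  rw [h1, h2, Polynomial.coeff_mul_C, Polynomial.coeff_map, algebraMap_eq, coeff_C_mul]

omit [DecidableEq σ] in
/-- A translated monomial, as a product. [folklore] -/
theorem translate_monomial_eq_prod (b : σ → K) (m : σ →₀ ℕ) (c : K) :
    translate b (monomial m c) = C c * ∏ i, (X i + C (b i)) ^ (m i) := by
  unfold translate
  rw [aeval_monomial, algebraMap_eq, Finsupp.prod_fintype _ _ (fun i => pow_zero _)]

/-- **The scaling substitution on a translated monomial.** Let `Φ` be the `K`-algebra map
`y_j ↦ y_j`, `y_i ↦ y_i + v·(y_i + b_i)` (`i ≠ j`) into `K[t, y]`, for any `v` (in the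
application `v = v(t)` is a polynomial in `t` without constant term, so that `Φ` is the scaling
`y_i + b_i ↦ (1 + v(t))·(y_i + b_i)` of the translated coordinates). Then
`Φ((y + b)^m) = (1 + v)^{Σ_{i ≠ j} m_i} · (y + b)^m` (`b_j = 0` is not even needed). [folklore] -/
theorem scale_translate_monomial (j : σ) (b : σ → K) (v : MvPolynomial (Option σ) K)
    (Φ : MvPolynomial σ K →ₐ[K] MvPolynomial (Option σ) K)
    (hΦ : ∀ i, Φ (X i) = if i = j then X (some j) else X (some i) + v * (X (some i) + C (b i)))
    (m : σ →₀ ℕ) (c : K) :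
    Φ (translate b (monomial m c)) =
      (1 + v) ^ (∑ i ∈ univ.erase j, m i) * rename some (translate b (monomial m c)) := by
  have hfac : ∀ i, Φ (X i) + C (b i) =
      (1 + v) ^ (if i = j then 0 else 1) * (X (some i) + C (b i)) := by
    intro i
    rw [hΦ i]
    by_cases hij : i = j
    · subst hij
      rw [if_pos rfl, if_pos rfl, pow_zero, one_mul]
    · rw [if_neg hij, if_neg hij, pow_one]
      ring
  have hsum : ∑ i, (if i = j then 0 else 1) * m i = ∑ i ∈ univ.erase j, m i := by
    rw [← Finset.add_sum_erase _ _ (Finset.mem_univ j), if_pos rfl, zero_mul, zero_add]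
    exact Finset.sum_congr rfl fun i hi => by rw [if_neg (Finset.ne_of_mem_erase hi), one_mul]
  have h1 : ∀ i, Φ ((X i + C (b i)) ^ (m i)) =
      ((1 + v) ^ (if i = j then 0 else 1)) ^ (m i) * (X (some i) + C (b i)) ^ (m i) := by
    intro i
    rw [map_pow, map_add, algHom_C, algebraMap_eq, hfac i, mul_pow]
  have h2 : ∀ i, rename some ((X i + C (b i)) ^ (m i)) =
      (X (some i) + C (b i) : MvPolynomial (Option σ) K) ^ (m i) := by
    intro i
    rw [map_pow, map_add, rename_X, rename_C]
  rw [translate_monomial_eq_prod, map_mul, algHom_C, algebraMap_eq, map_prod, map_mul, rename_C,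
    map_prod]
  simp_rw [h1, h2, Finset.prod_mul_distrib, ← pow_mul, Finset.prod_pow_eq_pow_sum, hsum]
  ring

end Scaling

/-! ## 3. The Hasse–Euler probe: operator identity, transfer, weights -/

section Probe

variable {σ : Type*} {K : Type*} [Field K] [Fintype σ] [DecidableEq σ]

omit [Fintype σ] [DecidableEq σ] in
/-- Powers of `t` under `aeval (X none)`: the support of `A(t)` in `K[t, y]`. [folklore] -/
theorem aeval_X_none_eq_sum (A : Polynomial K) :
    Polynomial.aeval (X none : MvPolynomial (Option σ) K) A =
      ∑ k ∈ A.support, monomial (Finsupp.single none k) (A.coeff k) := by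
  conv_lhs => rw [A.as_sum_support_C_mul_X_pow]
  rw [map_sum]
  refine Finset.sum_congr rfl fun k _ => ?_
  rw [map_mul, Polynomial.aeval_C, algebraMap_eq, map_pow, Polynomial.aeval_X,
    C_mul_X_pow_eq_monomial]

omit [Fintype σ] [DecidableEq σ] in
/-- The monomials of `A(t)` in `K[t, y]` are pure powers of `t`. [folklore] -/
theorem forall_support_aeval_X_none (A : Polynomial K) :
    ∀ M ∈ (Polynomial.aeval (X none : MvPolynomial (Option σ) K) A).support,
      ∃ k ∈ A.support, M = Finsupp.single none k := by
  classical
  rw [aeval_X_none_eq_sum]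
  exact forall_support_sum _ _ fun k hk => forall_support_monomial ⟨k, hk, rfl⟩ _

omit [DecidableEq σ] in
/-- The degree of an exponent `t^a y^β` of `K[t, y]`. [folklore] -/
theorem degree_optionElim (β : σ →₀ ℕ) (a : ℕ) : (β.optionElim a).degree = a + β.degree := by
  rw [Finsupp.degree_eq_sum, Finsupp.degree_eq_sum, Fintype.sum_option]
  simp only [Finsupp.optionElim_apply_none, Finsupp.optionElim_apply_some]

/-- **The Hasse–Euler probe is an operator applied to the translated chart transform**
(coefficientwise). With `G = translate b (chartTransform q j F)`, `Φ` the scaling substitution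
`y_i + b_i ↦ (1 + v(t))·(y_i + b_i)` (`i ≠ j`), `y_j ↦ y_j`, and any `A(t)`:
`[y^β] translate b (Σ_d w(d^)·c_d·y^{d^}) = [t^a y^β] (A(t) · Φ(G))`, where the weight of the
chart exponent `m = d^` is `w(m) = [t^a] (A(t)·(1 + v(t))^{Σ_{i ≠ j} m_i})` — the untranslated
monomial `(y + b)^m` is an eigenvector of the scaling with eigenvalue `(1 + v)^{Σ_{i≠j} m_i}`
(`scale_translate_monomial`). For `v = t` the operator `[t^a](Φ − )` is the total Hasse–Euler
operator `Σ_{|α| = a, α_j = 0} (y + b)^α ∂^{(α)}` of order `a` in the variables `y_i + b_i`,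
`i ≠ j`; the `e = 1`, `a = 1` instance is `translate_eulerProbe`. [folklore] -/
theorem coeff_translate_hasseEulerProbe (q : ℕ) (j : σ) (b : σ → K) (F : MvPolynomial σ K)
    (A₀ v₁ : Polynomial K) (a : ℕ) (Φ : MvPolynomial σ K →ₐ[K] MvPolynomial (Option σ) K)
    (hΦ : ∀ i, Φ (X i) = if i = j then X (some j) else
      X (some i) + Polynomial.aeval (X none) v₁ * (X (some i) + C (b i)))
    (β : σ →₀ ℕ) :
    coeff β (translate b (∑ d ∈ F.support, monomial (chartExponent q j d)
        ((A₀ * (1 + v₁) ^ (∑ i ∈ univ.erase j, chartExponent q j d i)).coeff a * coeff d F))) =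
      coeff (β.optionElim a) (Polynomial.aeval (X none : MvPolynomial (Option σ) K) A₀ *
        Φ (translate b (chartTransform q j F))) := by
  unfold chartTransform
  rw [translate_finset_sum, translate_finset_sum, map_sum, Finset.mul_sum, coeff_sum, coeff_sum]
  refine Finset.sum_congr rfl fun d _ => ?_
  have hA : ∀ N : ℕ, Polynomial.aeval (X none : MvPolynomial (Option σ) K) (A₀ * (1 + v₁) ^ N) =
      Polynomial.aeval (X none) A₀ * (1 + Polynomial.aeval (X none) v₁) ^ N := by
    intro N
    rw [map_mul, map_pow, map_add, map_one]
  rw [← C_mul_monomial, translate_C_mul, coeff_C_mul, scale_translate_monomial j b _ Φ hΦ,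
    ← mul_assoc, ← hA, coeff_optionElim_aeval_mul_rename]

/-- **Transfer, part 1: the exponent at `y_j` and the degree.** If `t^a y^β` is a monomial of
`A(t) · Φ(c·y^μ)` (`Φ` the scaling substitution with `v(0) = 0`), then `μ_j = β_j` (the
substitution does not touch `y_j` and produces no `y_j` elsewhere) and `|μ| ≤ |β| + a` (every
monomial of `Φ(y_i)` has degree `≥ 1` in `(t, y)`, so `Φ(y^μ)` has order `≥ |μ|`). [folklore] -/
theorem apply_eq_and_degree_le_of_coeff_scale_monomial (j : σ) (b : σ → K) (A₀ v₁ : Polynomial K)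
    (hv₁ : v₁.coeff 0 = 0) (Φ : MvPolynomial σ K →ₐ[K] MvPolynomial (Option σ) K)
    (hΦ : ∀ i, Φ (X i) = if i = j then X (some j) else
      X (some i) + Polynomial.aeval (X none) v₁ * (X (some i) + C (b i)))
    (μ : σ →₀ ℕ) (c : K) (β : σ →₀ ℕ) (a : ℕ)
    (h : coeff (β.optionElim a)
      (Polynomial.aeval (X none : MvPolynomial (Option σ) K) A₀ * Φ (monomial μ c)) ≠ 0) :
    μ j = β j ∧ μ.degree ≤ β.degree + a := by
  set v := Polynomial.aeval (X none : MvPolynomial (Option σ) K) v₁ with hvdef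
  set A := Polynomial.aeval (X none : MvPolynomial (Option σ) K) A₀ with hAdef
  have hM : β.optionElim a ∈ (A * Φ (monomial μ c)).support := MvPolynomial.mem_support_iff.mpr h
  have hmono : Φ (monomial μ c) = C c * ∏ i, Φ (X i) ^ (μ i) := by
    rw [monomial_eq, Finsupp.prod_fintype _ _ (fun _ => pow_zero _), map_mul, algHom_C,
      algebraMap_eq, map_prod]
    simp_rw [map_pow]
  have hΦj : Φ (X j) = X (some j) := by rw [hΦ j, if_pos rfl]
  have hsj : ∀ n : ℕ, (Finsupp.single (some j) n : Option σ →₀ ℕ) (some j) = n := fun n =>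
    Finsupp.single_eq_same
  have hsi : ∀ i, i ≠ j → ∀ n : ℕ, (Finsupp.single (some i) n : Option σ →₀ ℕ) (some j) = 0 :=
    fun i hij n => Finsupp.single_eq_of_ne fun h => hij (Option.some_injective _ h).symm
  have hsn : ∀ n : ℕ, (Finsupp.single none n : Option σ →₀ ℕ) (some j) = 0 := fun n =>
    Finsupp.single_eq_of_ne (Option.some_ne_none j)
  constructor
  · -- (i): the exponent at `y_j`
    have hQv : ∀ M ∈ v.support, M (some j) = 0 := by
      intro M hM
      obtain ⟨k, -, rfl⟩ := forall_support_aeval_X_none v₁ M hM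
      exact hsn k
    have hQA : ∀ M ∈ A.support, M (some j) = 0 := by
      intro M hM
      obtain ⟨k, -, rfl⟩ := forall_support_aeval_X_none A₀ M hM
      exact hsn k
    have hadd0 : ∀ a' c' : Option σ →₀ ℕ, a' (some j) = 0 → c' (some j) = 0 →
        (a' + c') (some j) = 0 := by
      intro a' c' ha hc
      rw [Finsupp.add_apply, ha, hc]
    have hQΦ : ∀ i, i ≠ j → ∀ M ∈ (Φ (X i)).support, M (some j) = 0 := by
      intro i hij
      rw [hΦ i, if_neg hij]
      exact forall_support_add (forall_support_X (hsi i hij 1))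
        (forall_support_mul (P := fun M => M (some j) = 0) (Q := fun M => M (some j) = 0)
          (S := fun M => M (some j) = 0) hadd0 hQv
          (forall_support_add (forall_support_X (hsi i hij 1))
            (forall_support_C (P := fun M => M (some j) = 0) rfl _)))
    have hrest : ∀ M ∈ (A * (C c * ∏ i ∈ univ.erase j, Φ (X i) ^ (μ i))).support,
        M (some j) = 0 := by
      refine forall_support_mul (P := fun M => M (some j) = 0) (Q := fun M => M (some j) = 0)
        (S := fun M => M (some j) = 0) hadd0 hQA
        (forall_support_mul (P := fun M => M (some j) = 0) (Q := fun M => M (some j) = 0)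
          (S := fun M => M (some j) = 0) hadd0
          (forall_support_C (P := fun M => M (some j) = 0) rfl _) ?_)
      have := forall_support_prod (P := fun _ M => M (some j) = 0) (R := K) rfl
        (fun _ _ a' c' ha hc => hadd0 a' c' ha hc) (univ.erase j) (fun i => Φ (X i) ^ (μ i))
        (fun _ => 0) (fun i hi => forall_support_pow (P := fun _ M => M (some j) = 0) (R := K)
          rfl (fun _ _ a' c' ha hc => hadd0 a' c' ha hc) (n := 0)
          (hQΦ i (Finset.ne_of_mem_erase hi)) (μ i))
      exact this
    have hprod : A * Φ (monomial μ c) =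
        X (some j) ^ (μ j) * (A * (C c * ∏ i ∈ univ.erase j, Φ (X i) ^ (μ i))) := by
      rw [hmono, ← Finset.mul_prod_erase _ _ (Finset.mem_univ j), hΦj]
      ring
    rw [hprod] at hM
    have key := forall_support_mul (P := fun M => M (some j) = μ j) (Q := fun M => M (some j) = 0)
      (S := fun M => M (some j) = μ j)
      (fun a' c' ha hc => by rw [Finsupp.add_apply, ha, hc, add_zero])
      (forall_support_X_pow (hsj (μ j))) hrest _ hM
    rw [Finsupp.optionElim_apply_some] at key
    exact key.symm
  · -- (ii): the degree
    have hP0 : (0 : ℕ) ≤ (0 : Option σ →₀ ℕ).degree := le_of_eq (by simp)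
    have hPadd : ∀ (n₁ n₂ : ℕ) (a' c' : Option σ →₀ ℕ), n₁ ≤ a'.degree → n₂ ≤ c'.degree →
        n₁ + n₂ ≤ (a' + c').degree := by
      intro n₁ n₂ a' c' ha hc
      rw [map_add]
      exact add_le_add ha hc
    have hv1 : ∀ M ∈ v.support, 1 ≤ M.degree := by
      intro M hM
      obtain ⟨k, hk, rfl⟩ := forall_support_aeval_X_none v₁ M hM
      rw [Finsupp.degree_single]
      rcases Nat.eq_zero_or_pos k with h0 | h0
      · subst h0; exact absurd hv₁ (Polynomial.mem_support_iff.mp hk)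
      · exact h0
    have hΦ1 : ∀ i, ∀ M ∈ (Φ (X i)).support, 1 ≤ M.degree := by
      intro i
      rw [hΦ i]
      by_cases hij : i = j
      · rw [if_pos hij]
        exact forall_support_X (by rw [Finsupp.degree_single])
      · rw [if_neg hij]
        refine forall_support_add (forall_support_X (by rw [Finsupp.degree_single]))
          (forall_support_mul (Q := fun _ => True) (fun a' c' ha _ => ?_) hv1 fun _ _ => trivial)
        rw [map_add]; exact le_add_right ha
    have hprodΦ : ∀ M ∈ (∏ i, Φ (X i) ^ (μ i)).support, μ.degree ≤ M.degree := by
      have := forall_support_prod (P := fun n M => n ≤ Finsupp.degree M) (R := K) hP0 hPadd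
        univ (fun i => Φ (X i) ^ (μ i)) (fun i => μ i * 1)
        (fun i _ => forall_support_pow (P := fun n M => n ≤ Finsupp.degree M) (R := K) hP0 hPadd
          (hΦ1 i) (μ i))
      simp only [mul_one] at this
      rwa [← Finsupp.degree_eq_sum] at this
    have key := forall_support_mul (P := fun _ => True) (Q := fun M => μ.degree ≤ Finsupp.degree M)
      (S := fun M => μ.degree ≤ Finsupp.degree M)
      (fun a' c' _ hc => by rw [map_add]; exact le_add_left hc) (fun _ _ => trivial)
      (forall_support_mul (P := fun _ => True) (Q := fun M => μ.degree ≤ Finsupp.degree M)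
        (S := fun M => μ.degree ≤ Finsupp.degree M)
        (fun a' c' _ hc => by rw [map_add]; exact le_add_left hc)
        (fun _ _ => trivial) hprodΦ) _ (by rwa [hmono] at hM)
    rw [degree_optionElim] at key
    omega

/-- **Transfer, part 2: flatness.** In characteristic `p`, `q = pᵉ`: if `q ∣ μ_i` for every
`i ≠ j` and `A(t) = B(t)^q`, then `A(t) · Φ(c·y^μ)` involves `t` only through `t^q`
(`Φ(y_i)^q = Φ(y_i^q)` is a polynomial in `t^q, y^q` by Frobenius); so a monomial `t^a y^β`
forces `q ∣ a`. [folklore] -/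
theorem pow_dvd_of_coeff_scale_monomial (p : ℕ) [hp : Fact p.Prime] [CharP K p] {e : ℕ} (j : σ)
    (B₀ : Polynomial K) (Φ : MvPolynomial σ K →ₐ[K] MvPolynomial (Option σ) K)
    (hΦj : Φ (X j) = X (some j)) (μ : σ →₀ ℕ) (hflat : ∀ i, i ≠ j → p ^ e ∣ μ i) (c : K)
    (β : σ →₀ ℕ) (a : ℕ)
    (h : coeff (β.optionElim a)
      (Polynomial.aeval (X none : MvPolynomial (Option σ) K) (B₀ ^ p ^ e) * Φ (monomial μ c)) ≠ 0) :
    p ^ e ∣ a := by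
  have hM := MvPolynomial.mem_support_iff.mpr h
  have hmono : Φ (monomial μ c) = C c * ∏ i, Φ (X i) ^ (μ i) := by
    rw [monomial_eq, Finsupp.prod_fintype _ _ (fun _ => pow_zero _), map_mul, algHom_C,
      algebraMap_eq, map_prod]
    simp_rw [map_pow]
  have hadd : ∀ a' c' : Option σ →₀ ℕ, p ^ e ∣ a' none → p ^ e ∣ c' none →
      p ^ e ∣ (a' + c') none := by
    intro a' c' ha hc
    rw [Finsupp.add_apply]
    exact dvd_add ha hc
  have hA : ∀ M ∈ (Polynomial.aeval (X none : MvPolynomial (Option σ) K) (B₀ ^ p ^ e)).support,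
      p ^ e ∣ M none := by
    rw [map_pow]
    exact fun M hM => forall_support_pow_char_pow p e _ M hM none
  have hΦi : ∀ i, ∀ M ∈ (Φ (X i) ^ (μ i)).support, p ^ e ∣ M none := by
    intro i
    by_cases hij : i = j
    · rw [hij, hΦj]
      refine forall_support_X_pow ?_
      rw [Finsupp.single_eq_of_ne (Option.some_ne_none j).symm]
      exact dvd_zero _
    · rw [← Nat.mul_div_cancel' (hflat i hij), pow_mul]
      exact forall_support_pow (P := fun _ M => p ^ e ∣ M none) (R := K) (dvd_zero _)
        (fun _ _ a' c' ha hc => hadd a' c' ha hc) (n := 0)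
        (fun M hM => forall_support_pow_char_pow p e _ M hM none) _
  have hprod : ∀ M ∈ (∏ i, Φ (X i) ^ (μ i)).support, p ^ e ∣ M none :=
    forall_support_prod (P := fun _ M => p ^ e ∣ M none) (R := K) (dvd_zero _)
      (fun _ _ a' c' ha hc => hadd a' c' ha hc) univ _ (fun _ => 0) (fun i _ => hΦi i)
  rw [hmono] at hM
  have key := forall_support_mul (P := fun M => p ^ e ∣ M none) (Q := fun M => p ^ e ∣ M none)
    (S := fun M => p ^ e ∣ M none) hadd hA
    (forall_support_mul (P := fun M => p ^ e ∣ M none) (Q := fun M => p ^ e ∣ M none)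
      (S := fun M => p ^ e ∣ M none) hadd
      (forall_support_C (P := fun M => p ^ e ∣ M none) (dvd_zero _) _) hprod) _ hM
  rwa [Finsupp.optionElim_apply_none] at key

/-- **Transfer, part 3: the translation budget.** If moreover `q = pᵉ` divides `μ_i` at every
TRANSLATED index `i ≠ j` (`b_i ≠ 0`) and `a < q`, then `|μ| ≤ |β|`: with `v(0) = 0`, a monomial
`t^c y^m` of `Φ(y_i)^{μ_i} = (Φ(y_i)^q)^{μ_i/q}` has `q ∣ c` and `|m| + c ≥ μ_i`, so the graded
quantity `|m| + q⌊c/q⌋` is `≥ μ_i` on every factor, `≥ |μ|` on the product, and equals `|β|` at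
`t^a y^β` because `⌊a/q⌋ = 0` — the `t`-budget `a` cannot pay for a single lost `y`-degree.
(Contrapositive, used below: if `|μ| > |β|` then some translated exponent of `μ` is not divisible
by `q`.) [folklore] -/
theorem degree_le_of_coeff_scale_monomial_of_flat (p : ℕ) [hp : Fact p.Prime] [CharP K p]
    {e : ℕ} (j : σ) (b : σ → K) (A₀ v₁ : Polynomial K) (hv₁ : v₁.coeff 0 = 0)
    (Φ : MvPolynomial σ K →ₐ[K] MvPolynomial (Option σ) K)
    (hΦ : ∀ i, Φ (X i) = if i = j then X (some j) else
      X (some i) + Polynomial.aeval (X none) v₁ * (X (some i) + C (b i)))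
    (μ : σ →₀ ℕ) (hflat : ∀ i, i ≠ j → b i ≠ 0 → p ^ e ∣ μ i) (c : K) (β : σ →₀ ℕ) {a : ℕ}
    (ha : a < p ^ e)
    (h : coeff (β.optionElim a)
      (Polynomial.aeval (X none : MvPolynomial (Option σ) K) A₀ * Φ (monomial μ c)) ≠ 0) :
    μ.degree ≤ β.degree := by
  set q : ℕ := p ^ e with hqdef
  have hq0 : 0 < q := pow_pos hp.out.pos e
  set v := Polynomial.aeval (X none : MvPolynomial (Option σ) K) v₁ with hvdef
  set A := Polynomial.aeval (X none : MvPolynomial (Option σ) K) A₀ with hAdef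
  have hM : β.optionElim a ∈ (A * Φ (monomial μ c)).support := MvPolynomial.mem_support_iff.mpr h
  have hmono : Φ (monomial μ c) = C c * ∏ i, Φ (X i) ^ (μ i) := by
    rw [monomial_eq, Finsupp.prod_fintype _ _ (fun _ => pow_zero _), map_mul, algHom_C,
      algebraMap_eq, map_prod]
    simp_rw [map_pow]
  -- `y`-degree of an exponent of `K[t, y]`
  have hyd_none : ∀ k : ℕ, ∑ i, (Finsupp.single none k : Option σ →₀ ℕ) (some i) = 0 := by
    intro k
    exact Finset.sum_eq_zero fun i _ => Finsupp.single_eq_of_ne (Option.some_ne_none i)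
  have hyd_some : ∀ (i : σ) (k : ℕ), ∑ l, (Finsupp.single (some i) k : Option σ →₀ ℕ) (some l) = k := by
    intro i k
    rw [Finset.sum_eq_single i]
    · exact Finsupp.single_eq_same
    · intro l _ hl
      exact Finsupp.single_eq_of_ne fun h' => hl (Option.some_injective _ h')
    · intro hi; exact absurd (Finset.mem_univ i) hi
  have hdeg_opt : ∀ M : Option σ →₀ ℕ, M.degree = M none + ∑ i, M (some i) := by
    intro M
    rw [Finsupp.degree_eq_sum, Fintype.sum_option]
  -- the graded predicate `P n M : n ≤ Σ_i M(some i) + q·(M none / q)`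
  have hP0 : (0 : ℕ) ≤ (∑ i, (0 : Option σ →₀ ℕ) (some i)) + q * ((0 : Option σ →₀ ℕ) none / q) :=
    Nat.zero_le _
  have hPadd : ∀ (n₁ n₂ : ℕ) (a' c' : Option σ →₀ ℕ),
      n₁ ≤ (∑ i, a' (some i)) + q * (a' none / q) →
      n₂ ≤ (∑ i, c' (some i)) + q * (c' none / q) →
      n₁ + n₂ ≤ (∑ i, (a' + c') (some i)) + q * ((a' + c') none / q) := by
    intro n₁ n₂ a' c' h1 h2
    have h3 : q * (a' none / q + c' none / q) ≤ q * ((a' none + c' none) / q) :=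
      Nat.mul_le_mul_left q (Nat.add_div_le_add_div _ _ _)
    simp only [Finsupp.add_apply, Finset.sum_add_distrib]
    rw [Nat.mul_add] at h3
    omega
  -- the factors
  have hA' : ∀ M ∈ A.support, (0 : ℕ) ≤ (∑ i, M (some i)) + q * (M none / q) :=
    fun M _ => Nat.zero_le _
  have hΦ1 : ∀ i, ∀ M ∈ (Φ (X i)).support, 1 ≤ M.degree := by
    intro i
    rw [hΦ i]
    by_cases hij : i = j
    · rw [if_pos hij]
      exact forall_support_X (by rw [Finsupp.degree_single])
    · rw [if_neg hij]
      have hv1 : ∀ M ∈ v.support, 1 ≤ M.degree := by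
        intro M hM'
        obtain ⟨k, hk, rfl⟩ := forall_support_aeval_X_none v₁ M hM'
        rw [Finsupp.degree_single]
        rcases Nat.eq_zero_or_pos k with h0 | h0
        · subst h0; exact absurd hv₁ (Polynomial.mem_support_iff.mp hk)
        · exact h0
      refine forall_support_add (forall_support_X (by rw [Finsupp.degree_single]))
        (forall_support_mul (Q := fun _ => True) (fun a' c' ha' _ => ?_) hv1 fun _ _ => trivial)
      rw [map_add]; exact le_add_right ha'
  have hΦμ : ∀ i, ∀ M ∈ (Φ (X i) ^ (μ i)).support,
      μ i ≤ (∑ l, M (some l)) + q * (M none / q) := by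
    intro i
    by_cases hij : i = j
    · rw [hij, hΦ j, if_pos rfl]
      refine forall_support_X_pow ?_
      rw [hyd_some]
      exact Nat.le_add_right _ _
    · by_cases hbi : b i = 0
      · -- untranslated: `Φ(y_i) = y_i + v·y_i`, every monomial has `y`-degree `1`
        have hone : ∀ M ∈ (Φ (X i)).support, 1 ≤ (∑ l, M (some l)) + q * (M none / q) := by
          rw [hΦ i, if_neg hij, hbi, C_0, add_zero]
          refine forall_support_add (forall_support_X ?_)
            (forall_support_mul (P := fun M => (0 : ℕ) ≤ (∑ l, M (some l)) + q * (M none / q))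
              (Q := fun M => 1 ≤ (∑ l, M (some l)) + q * (M none / q))
              (S := fun M => 1 ≤ (∑ l, M (some l)) + q * (M none / q))
              (fun a' c' ha' hc' => by have := hPadd 0 1 a' c' ha' hc'; simpa using this)
              (fun M _ => Nat.zero_le _) (forall_support_X ?_))
          all_goals rw [hyd_some]; exact Nat.le_add_right _ _
        have := forall_support_pow (P := fun n M => n ≤ (∑ l, M (some l)) + q * (M none / q))
          (R := K) hP0 hPadd hone (μ i)
        simpa only [mul_one] using this
      · -- translated and `q ∣ μ_i`: go through `Φ(y_i)^q`, whose monomials are `q • M'`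
        have hq : ∀ M ∈ (Φ (X i) ^ q).support, q ≤ (∑ l, M (some l)) + q * (M none / q) := by
          intro M hM'
          obtain ⟨M', hM'', rfl⟩ := exists_smul_of_mem_support_pow_char_pow p e (Φ (X i)) M hM'
          have h1 := hΦ1 i M' hM''
          rw [hdeg_opt] at h1
          rw [← hqdef]
          simp only [Finsupp.smul_apply, smul_eq_mul, ← Finset.mul_sum,
            Nat.mul_div_cancel_left _ hq0]
          calc q = q * 1 := (mul_one q).symm
            _ ≤ q * (M' none + ∑ l, M' (some l)) := Nat.mul_le_mul_left q h1
            _ = q * ∑ l, M' (some l) + q * M' none := by ring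
        have := forall_support_pow (P := fun n M => n ≤ (∑ l, M (some l)) + q * (M none / q))
          (R := K) hP0 hPadd hq (μ i / q)
        rw [Nat.div_mul_cancel (hflat i hij hbi), ← pow_mul, Nat.mul_div_cancel' (hflat i hij hbi)]
          at this
        exact this
  have hprod : ∀ M ∈ (∏ i, Φ (X i) ^ (μ i)).support,
      μ.degree ≤ (∑ l, M (some l)) + q * (M none / q) := by
    have := forall_support_prod (P := fun n M => n ≤ (∑ l, M (some l)) + q * (M none / q))
      (R := K) hP0 hPadd univ (fun i => Φ (X i) ^ (μ i)) (fun i => μ i) (fun i _ => hΦμ i)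
    rwa [← Finsupp.degree_eq_sum] at this
  rw [hmono] at hM
  have key := forall_support_mul (P := fun M => (0 : ℕ) ≤ (∑ l, M (some l)) + q * (M none / q))
    (Q := fun M => μ.degree ≤ (∑ l, M (some l)) + q * (M none / q))
    (S := fun M => μ.degree ≤ (∑ l, M (some l)) + q * (M none / q))
    (fun a' c' ha' hc' => by have := hPadd 0 _ a' c' ha' hc'; simpa using this) hA'
    (forall_support_mul (P := fun M => (0 : ℕ) ≤ (∑ l, M (some l)) + q * (M none / q))
      (Q := fun M => μ.degree ≤ (∑ l, M (some l)) + q * (M none / q))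
      (S := fun M => μ.degree ≤ (∑ l, M (some l)) + q * (M none / q))
      (fun a' c' ha' hc' => by have := hPadd 0 _ a' c' ha' hc'; simpa using this)
      (fun M _ => Nat.zero_le _) hprod) _ hM
  simp only [Finsupp.optionElim_apply_some, Finsupp.optionElim_apply_none,
    Nat.div_eq_of_lt ha, mul_zero, add_zero] at key
  rwa [← Finsupp.degree_eq_sum] at key

/-- **The weights of the probe on initial monomials.** With `v(t) = −t + t² − ⋯ ± t^a` (so that
`(1 + t)(1 + v(t)) = 1 − (−t)^{a+1} ≡ 1 (mod t^{a+1})`) and `N ≤ o`: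
`[t^a] (1 + t)^o (1 + v(t))^N = (o − N choose a)`. [folklore] -/
theorem coeff_weight_eq_choose (o N a : ℕ) (hN : N ≤ o) :
    ((1 + Polynomial.X) ^ o *
        (1 + ∑ l ∈ range a, (-Polynomial.X : Polynomial K) ^ (l + 1)) ^ N).coeff a =
      ((o - N).choose a : K) := by
  have hgeom : (1 + Polynomial.X) * (1 + ∑ l ∈ range a, (-Polynomial.X : Polynomial K) ^ (l + 1)) =
      1 - (-Polynomial.X) ^ (a + 1) := by
    have h := mul_neg_geom_sum (-Polynomial.X : Polynomial K) (a + 1)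
    rw [sub_neg_eq_add, Finset.sum_range_succ', pow_zero, add_comm (∑ l ∈ range a, _) 1] at h
    exact h
  have hsplit : (1 + Polynomial.X) ^ o *
      (1 + ∑ l ∈ range a, (-Polynomial.X : Polynomial K) ^ (l + 1)) ^ N =
      (1 + Polynomial.X) ^ (o - N) * (1 - (-Polynomial.X) ^ (a + 1)) ^ N := by
    rw [← hgeom, mul_pow, ← mul_assoc, ← pow_add, Nat.sub_add_cancel hN]
  have hd : (Polynomial.X : Polynomial K) ^ (a + 1) ∣ (1 - (-Polynomial.X) ^ (a + 1)) ^ N - 1 := by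
    have h1 := sub_dvd_pow_sub_pow (1 - (-Polynomial.X : Polynomial K) ^ (a + 1)) 1 N
    rw [one_pow, sub_sub_cancel_left] at h1
    refine dvd_trans ?_ h1
    rw [dvd_neg, neg_pow]
    exact Dvd.intro_left _ rfl
  obtain ⟨R, hR⟩ := hd
  have hR2 : (1 - (-Polynomial.X : Polynomial K) ^ (a + 1)) ^ N = 1 + Polynomial.X ^ (a + 1) * R := by
    rw [← hR]; ring
  rw [hsplit, hR2, mul_add, mul_one, mul_left_comm, Polynomial.coeff_add,
    Polynomial.coeff_one_add_X_pow, Polynomial.coeff_X_pow_mul', if_neg (by omega), add_zero]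

/-- The truncated inverse has no constant term. [folklore] -/
theorem coeff_zero_truncInv (a : ℕ) :
    (∑ l ∈ range a, (-Polynomial.X : Polynomial K) ^ (l + 1)).coeff 0 = 0 := by
  rw [Polynomial.finsetSum_coeff]
  refine Finset.sum_eq_zero fun l _ => ?_
  rw [neg_pow, Polynomial.coeff_mul_X_pow', if_neg (by omega)]

end Probe

/-! ## 4. The theorems -/

section Main

variable {σ : Type*} {K : Type*} [Field K] [Fintype σ] [DecidableEq σ] [DecidableEq K]
variable (p : ℕ) [hp : Fact p.Prime] [CharP K p]

/-- **Probe 3 at order `q = pᵉ` (the Hasse–Euler operator of order `p^k`): the chart of a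
non-exceptional `q`-witness.** Let `y_j` be NON-exceptional (`r_j = 0`) and suppose some initial
monomial `y^{d₀}` of `F` (`|d₀| = ord₀ F = o ≥ q`) has `q ∤ (d₀)_j`. Blow up the origin and pass to
ANY point `b` of the `y_j`-chart (`b_j = 0`). Then the new residual polynomial has a monomial `y^E`
in its lowest `y_j`-layer (`E_j = o − q`), surviving the cleaning, with EITHER `|E| ≤ |r′| + shade − 1`
(a strict drop of the shade) OR `|E| ≤ |r′| + shade` and `q ∤ E_i` at some TRANSLATED index `i ≠ j`
(`b_i ≠ 0`, so `y_i` is non-exceptional in the new state) — the same dichotomy as the `e = 1`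
template `exists_support_step_of_not_dvd_self`; the second alternative is what makes a `q`-witness
persist under a stall (`exists_pow_witness_step_of_shade_eq`). The dichotomy is the translation
budget of `degree_le_of_coeff_scale_monomial_of_flat`: if every translated exponent of the
transferred monomial `y^μ` were `q`-divisible, then `|μ| ≤ |β| ≤ |r′| + shade − p^k`.
Mechanism (the `e = 1` instance is `exists_support_step_of_not_dvd_self`, whose relative Euler
operator `o·G − Σ_{i≠j}(y_i + b_i)∂_i G` has weight `d_j` on the initial monomials): let `p^k`
(`k < e`) be a `p`-adic digit of `(d₀)_j` which is non-zero, `a = p^k`, and in the auxiliary ring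
`K[t, y]` let `Φ` scale the translated coordinates `y_i + b_i`, `i ≠ j`, by `1 + v(t)`,
`v(t) = −t + t² − ⋯ ± t^a` (so `(1 + t)(1 + v) ≡ 1 mod t^{a+1}`). The probe polynomial
`P = Σ_d w(d^)·c_d·y^{d^}`, `w(m) = [t^a](1 + t)^o (1 + v)^{Σ_{i≠j} m_i}`, has weight
`(d_j choose p^k)` on the initial monomials (`coeff_weight_eq_choose`), i.e. (Lucas) the `k`-th
digit of `d_j`: non-zero at `d₀`, and non-zero only if `d_j ≥ p^k`, so that the lowest `y_j`-layer
of `P` is non-empty and of degrees `≤ |ρ| + shade − p^k` (`ρ = r.update j (o − q)`, using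
`r_j = 0`). The layer lemma gives a monomial `y^β` of `translate b P` with `β_j = o − q`,
`|β| ≤ |r′| + shade − p^k`; by the operator identity (`coeff_translate_hasseEulerProbe`) `t^a y^β`
is a monomial of `(1 + t)^o · Φ(G)`, `G` the translated chart transform, hence of
`(1 + t)^o · Φ(c_μ y^μ)` for some monomial `y^μ` of `G`, and the transfer lemmas give `μ_j = β_j`,
`|μ| ≤ |β| + p^k ≤ |r′| + shade`, and — if `y^μ` were a `q`-th power, whence `q ∣ o` — `q ∣ p^k`,
absurd. Not in [Moh87] (whose Stability Theorem is stated for `e = 1` only in this form) nor in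
[HauserPerlega2019PRIMS] (whose assertion (7) concerns the indices `i ≠ j`); the statement is the
`q = pᵉ` analogue of Moh's case (1) extended to the translated points of the chart.
[cite: Moh1987, §1 (p. 972, Statement (i)–(iii) and case (1))]
[cite: HauserPerlega2019PRIMS, §3 Theorem (7)] -/
theorem exists_support_step_of_not_pow_dvd_self' {e : ℕ} (j : σ) (b : σ → K) (hbj : b j = 0)
    (s : State σ K) {o : ℕ} (ho : ordZero s.F = o) (hqo : p ^ e ≤ o)
    (hr : ∀ d ∈ s.F.support, s.r ≤ d) (hrj : s.r j = 0) {d₀ : σ →₀ ℕ} (hd₀ : d₀ ∈ s.F.support)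
    (hd₀deg : d₀.degree = o) (hd₀j : ¬ p ^ e ∣ d₀ j) :
    ∃ E ∈ (step (p ^ e) j b s).F.support, E j = o - p ^ e ∧
      (E.degree + 1 ≤ (step (p ^ e) j b s).r.degree + (o - s.r.degree) ∨
       (E.degree ≤ (step (p ^ e) j b s).r.degree + (o - s.r.degree) ∧
        ∃ i, i ≠ j ∧ b i ≠ 0 ∧ ¬ p ^ e ∣ E i)) := by
  have hdeg := le_degree_of_ordZero_eq s ho
  -- the order `a = p^k` of the probe: a non-zero `p`-adic digit of `(d₀)_j` below `e`
  obtain ⟨k, hk, hck⟩ := exists_natCast_choose_prime_pow_ne_zero p K hd₀j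
  set a : ℕ := p ^ k with hadef
  have ha0 : 0 < a := pow_pos hp.out.pos k
  have haq : a < p ^ e := Nat.pow_lt_pow_right hp.out.one_lt hk
  have hnq : ¬ p ^ e ∣ a := Nat.not_dvd_of_pos_of_lt ha0 haq
  have had₀ : a ≤ d₀ j := by
    by_contra hlt
    exact hck (by rw [Nat.choose_eq_zero_of_lt (not_le.mp hlt), Nat.cast_zero])
  -- `|r| + a ≤ o`
  have hro : s.r.degree + a ≤ o := by
    have h1 := degree_eq_add_sum_erase j s.r
    have h2 := degree_eq_add_sum_erase j d₀
    have h3 : ∑ i ∈ univ.erase j, s.r i ≤ ∑ i ∈ univ.erase j, d₀ i :=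
      Finset.sum_le_sum fun i _ => Finsupp.le_def.mp (hr d₀ hd₀) i
    omega
  set q : ℕ := p ^ e with hqdef
  set ρ : σ →₀ ℕ := s.r.update j (o - q) with hρdef
  have hρj : ρ j = o - q := by rw [hρdef, Finsupp.update_apply, if_pos rfl]
  have hρi : ∀ i, i ≠ j → ρ i = s.r i := fun i hi => by
    rw [hρdef, Finsupp.update_apply, if_neg hi]
  have hρdeg : ρ.degree = s.r.degree + (o - q) := by
    have := degree_update_add s.r j (o - q)
    rw [← hρdef, hrj] at this
    omega
  -- the weights and the probe polynomial
  set v₁ : Polynomial K := ∑ l ∈ range a, (-Polynomial.X : Polynomial K) ^ (l + 1) with hv₁def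
  set A₀ : Polynomial K := (1 + Polynomial.X) ^ o with hA₀def
  set w : (σ →₀ ℕ) → K := fun m => (A₀ * (1 + v₁) ^ (∑ i ∈ univ.erase j, m i)).coeff a
    with hwdef
  set g : (σ →₀ ℕ) → K := fun d => w (chartExponent q j d) * coeff d s.F with hgdef
  set Po : MvPolynomial σ K := ∑ d ∈ s.F.support, monomial (chartExponent q j d) (g d) with hPo
  have hsuppPo : ∀ e' ∈ Po.support, ∃ d ∈ s.F.support, g d ≠ 0 ∧ chartExponent q j d = e' :=
    fun e' he' => exists_of_mem_support_sum_monomial _ _ _ he'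
  have hρle : ∀ e' ∈ Po.support, ρ ≤ e' := by
    intro e' he'
    obtain ⟨d, hd, -, rfl⟩ := hsuppPo e' he'
    rw [Finsupp.le_def]
    intro i
    rw [chartExponent_apply]
    by_cases hij : i = j
    · subst hij
      rw [if_pos rfl, hρj]
      have := hdeg d hd
      omega
    · rw [if_neg hij, hρi i hij]
      exact Finsupp.le_def.mp (hr d hd) i
  -- on the initial monomials the weight is `(d_j choose p^k)`: the `k`-th `p`-adic digit of `d_j`
  have hw : ∀ d ∈ s.F.support, d.degree = o →
      w (chartExponent q j d) = (((d j).choose a : ℕ) : K) := by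
    intro d hd hdo
    have hN : ∑ i ∈ univ.erase j, chartExponent q j d i = o - d j := by
      have h1 : ∑ i ∈ univ.erase j, chartExponent q j d i = ∑ i ∈ univ.erase j, d i :=
        Finset.sum_congr rfl fun i hi => by
          rw [chartExponent_apply, if_neg (Finset.ne_of_mem_erase hi)]
      have h2 := degree_eq_add_sum_erase j d
      omega
    show (A₀ * (1 + v₁) ^ (∑ i ∈ univ.erase j, chartExponent q j d i)).coeff a = _
    rw [hN, hA₀def, hv₁def, coeff_weight_eq_choose o (o - d j) a (Nat.sub_le o (d j)),
      Nat.sub_sub_self (hdo ▸ Finsupp.le_degree j d)]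
  have hlow : ∀ d ∈ s.F.support, g d ≠ 0 → d.degree = o → a ≤ d j := by
    intro d hd hgd hdo
    by_contra hlt
    apply hgd
    show w (chartExponent q j d) * coeff d s.F = 0
    rw [hw d hd hdo, Nat.choose_eq_zero_of_lt (not_le.mp hlt), Nat.cast_zero, zero_mul]
  have hD : ∀ e' ∈ Po.support, e' j = ρ j → e'.degree ≤ ρ.degree + (o - s.r.degree - a) := by
    intro e' he' hej
    obtain ⟨d, hd, hgd, rfl⟩ := hsuppPo e' he'
    rw [chartExponent_apply, if_pos rfl, hρj] at hej
    have h1 := hdeg d hd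
    have h2 : d.degree = o := by omega
    have h3 := hlow d hd hgd h2
    rw [degree_chartExponent, h2, hρdeg]
    omega
  have hgd₀ : g d₀ ≠ 0 := by
    show w (chartExponent q j d₀) * coeff d₀ s.F ≠ 0
    rw [hw d₀ hd₀ hd₀deg]
    exact mul_ne_zero hck (MvPolynomial.mem_support_iff.mp hd₀)
  have hlayer : ∃ e' ∈ Po.support, e' j = ρ j := by
    refine ⟨chartExponent q j d₀, ?_, ?_⟩
    · rw [MvPolynomial.mem_support_iff, hPo,
        coeff_sum_monomial_of_injOn s.F.support (chartExponent q j) g hd₀]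
      · exact hgd₀
      · intro d hd _ h
        exact chartExponent_injective (le_trans hqo (hdeg d hd)) (le_trans hqo (hdeg d₀ hd₀)) h
    · rw [chartExponent_apply, if_pos rfl, hd₀deg, hρj]
  obtain ⟨β, hβ, hβj, hβdeg⟩ :=
    exists_mem_support_translate_layer b hbj Po ρ hρle (o - s.r.degree - a) hD hlayer
  -- the new multiplicities are `ρ` filtered
  have hr1 : (step q j b s).r = ρ.filter (fun i => b i = 0) := by
    show newMult q j b s = _
    rw [newMult_eq q j b hbj s ho, hρdef]
  -- read `β` through the operator identity in `K[t, y]`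
  set Φ : MvPolynomial σ K →ₐ[K] MvPolynomial (Option σ) K :=
    aeval (fun i => if i = j then X (some j) else
      X (some i) + Polynomial.aeval (X none) v₁ * (X (some i) + C (b i))) with hΦdef
  have hΦ : ∀ i, Φ (X i) = if i = j then X (some j) else
      X (some i) + Polynomial.aeval (X none) v₁ * (X (some i) + C (b i)) := fun i => by
    rw [hΦdef, aeval_X]
  set G : MvPolynomial σ K := pointTransform q j b s with hGdef
  have hident : coeff β (translate b Po) = coeff (β.optionElim a)
      (Polynomial.aeval (X none : MvPolynomial (Option σ) K) A₀ * Φ G) := by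
    rw [hPo, hGdef]
    exact coeff_translate_hasseEulerProbe q j b s.F A₀ v₁ a Φ hΦ β
  have hβne : coeff (β.optionElim a)
      (Polynomial.aeval (X none : MvPolynomial (Option σ) K) A₀ * Φ G) ≠ 0 := by
    rw [← hident]
    exact MvPolynomial.mem_support_iff.mp hβ
  have hexp : Polynomial.aeval (X none : MvPolynomial (Option σ) K) A₀ * Φ G =
      ∑ μ ∈ G.support, Polynomial.aeval (X none : MvPolynomial (Option σ) K) A₀ *
        Φ (monomial μ (coeff μ G)) := by
    conv_lhs => rw [G.as_sum]
    rw [map_sum, Finset.mul_sum]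
  rw [hexp, coeff_sum] at hβne
  obtain ⟨μ, hμG, hμne⟩ := Finset.exists_ne_zero_of_sum_ne_zero hβne
  obtain ⟨hμj, hμdeg⟩ := apply_eq_and_degree_le_of_coeff_scale_monomial j b A₀ v₁
    (coeff_zero_truncInv a) Φ hΦ μ _ β a hμne
  -- `y^μ` survives the cleaning: were it a `q`-th power, `q ∣ o` and the flatness transfer
  -- would give `q ∣ p^k`
  have hnot : ¬ IsPthPowerExponent q μ := by
    intro hP
    have hall := (isPthPowerExponent_iff q μ).mp hP
    have hqo' : q ∣ o := by
      have h1 : q ∣ μ j := hall j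
      rw [hμj, hβj, hρj] at h1
      have : o = (o - q) + q := by omega
      rw [this]
      exact dvd_add h1 (dvd_refl q)
    have hA₀ : A₀ = ((1 + Polynomial.X) ^ (o / q)) ^ q := by
      rw [hA₀def, ← pow_mul, Nat.div_mul_cancel hqo']
    rw [hA₀] at hμne
    exact hnq (pow_dvd_of_coeff_scale_monomial p j _ Φ (by rw [hΦ j, if_pos rfl]) μ
      (fun i _ => hall i) _ β a hμne)
  have hμF : μ ∈ (step q j b s).F.support := by
    show μ ∈ (deletePthPowers q (pointTransform q j b s)).support
    rw [MvPolynomial.mem_support_iff, coeff_deletePthPowers, if_neg hnot]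
    exact MvPolynomial.mem_support_iff.mp hμG
  refine ⟨μ, hμF, by rw [hμj, hβj, hρj], ?_⟩
  -- Case A (all translated exponents of `y^μ` are `q`-divisible): the `t`-budget cannot pay for a
  -- lost degree, `|μ| ≤ |β| ≤ |r′| + shade − p^k`; Case B: a translated non-`q`-divisible index
  by_cases hflat : ∀ i, i ≠ j → b i ≠ 0 → q ∣ μ i
  · left
    have hle := degree_le_of_coeff_scale_monomial_of_flat p j b A₀ v₁ (coeff_zero_truncInv a) Φ hΦ
      μ hflat _ β haq hμne
    rw [hr1]
    omega
  · right
    push Not at hflat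
    obtain ⟨i, hij, hbi, hndvd⟩ := hflat
    refine ⟨?_, i, hij, hbi, hndvd⟩
    rw [hr1]
    omega

/-- **Probe 3 at order `q = pᵉ`, degree bound only**: in the chart of a non-exceptional
`q`-witness the new residual polynomial has a monomial in its lowest `y_j`-layer, surviving the
cleaning, of degree `≤ |r′| + shade`. [cite: Moh1987, §1 (p. 972, cases (1)–(2))] -/
theorem exists_support_step_of_not_pow_dvd_self {e : ℕ} (j : σ) (b : σ → K) (hbj : b j = 0)
    (s : State σ K) {o : ℕ} (ho : ordZero s.F = o) (hqo : p ^ e ≤ o)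
    (hr : ∀ d ∈ s.F.support, s.r ≤ d) (hrj : s.r j = 0) {d₀ : σ →₀ ℕ} (hd₀ : d₀ ∈ s.F.support)
    (hd₀deg : d₀.degree = o) (hd₀j : ¬ p ^ e ∣ d₀ j) :
    ∃ E ∈ (step (p ^ e) j b s).F.support,
      E j = o - p ^ e ∧ E.degree ≤ (step (p ^ e) j b s).r.degree + (o - s.r.degree) := by
  obtain ⟨E, hE, hEj, h⟩ :=
    exists_support_step_of_not_pow_dvd_self' p j b hbj s ho hqo hr hrj hd₀ hd₀deg hd₀j
  refine ⟨E, hE, hEj, ?_⟩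
  rcases h with h | ⟨h, -⟩
  · omega
  · exact h

/-- **No increase in the chart of a non-exceptional `q`-witness, `q = pᵉ`, every `e`, every
dimension**: if `r_j = 0` and an initial monomial of `F` has `q ∤ d_j`, the shade does not
increase at any point of the `y_j`-chart. [cite: Moh1987, §1 (p. 972, cases (1)–(2))] -/
theorem shade_step_le_of_not_pow_dvd_self {e : ℕ} (j : σ) (b : σ → K) (hbj : b j = 0)
    (s : State σ K) {o : ℕ} (ho : ordZero s.F = o) (hqo : p ^ e ≤ o)
    (hr : ∀ d ∈ s.F.support, s.r ≤ d) (hrj : s.r j = 0) {d₀ : σ →₀ ℕ} (hd₀ : d₀ ∈ s.F.support)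
    (hd₀deg : d₀.degree = o) (hd₀j : ¬ p ^ e ∣ d₀ j) : (step (p ^ e) j b s).shade ≤ s.shade := by
  obtain ⟨E, hE, -, hEdeg⟩ :=
    exists_support_step_of_not_pow_dvd_self p j b hbj s ho hqo hr hrj hd₀ hd₀deg hd₀j
  rw [shade_eq_of_ordZero_eq s ho]
  exact shade_le_of_mem_support _ hE hEdeg

/-- **A `q`-witness forbids an increase, in every chart and every dimension** (`q = pᵉ`, every
`e`). If some NON-exceptional variable `y_{i₀}` (`r_{i₀} = 0`) occurs in an initial monomial of the
residual polynomial `F` with an exponent NOT divisible by `q`, then NO point blow-up (any chart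
`y_j`, any point `b` of its exceptional divisor, `b_j = 0`) increases the shade: the charts
`j ≠ i₀` are the Hasse probe of gen 14 (`shade_step_le_of_choose_ne_zero`, Hauser–Perlega's
assertion (7)), the chart `j = i₀` is Probe 3 above. The `e = 1` instance is
`shade_step_le_of_witness` (Moh's "`X`-kind variable" argument, [Moh87] p. 972).
[cite: Moh1987, §1 (p. 972, cases (1)–(2))] [cite: HauserPerlega2019PRIMS, §3 Theorem (7)] -/
theorem shade_step_le_of_pow_witness {e : ℕ} (j : σ) (b : σ → K) (hbj : b j = 0)
    (s : State σ K) {o : ℕ} (ho : ordZero s.F = o) (hqo : p ^ e ≤ o)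
    (hr : ∀ d ∈ s.F.support, s.r ≤ d) {i₀ : σ} (hri₀ : s.r i₀ = 0) {d₀ : σ →₀ ℕ}
    (hd₀ : d₀ ∈ s.F.support) (hd₀deg : d₀.degree = o) (hd₀i : ¬ p ^ e ∣ d₀ i₀) :
    (step (p ^ e) j b s).shade ≤ s.shade := by
  by_cases h : i₀ = j
  · subst h
    exact shade_step_le_of_not_pow_dvd_self p i₀ b hbj s ho hqo hr hri₀ hd₀ hd₀deg hd₀i
  · obtain ⟨k, hk, hck⟩ := exists_natCast_choose_prime_pow_ne_zero p K hd₀i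
    exact shade_step_le_of_choose_ne_zero p j b hbj s ho hqo hr h (Or.inr hri₀) hk hd₀ hd₀deg hck

/-- The same, as a statement about the atlas predicate: a state with a `q`-witness has NO
kangaroo point above it in any chart (`¬ ShadeIncreases`). [cite: Moh1987, §1 (p. 972)] -/
theorem not_shadeIncreases_of_pow_witness {e : ℕ} (j : σ) (b : σ → K) (hbj : b j = 0)
    (s : State σ K) {o : ℕ} (ho : ordZero s.F = o) (hqo : p ^ e ≤ o)
    (hr : ∀ d ∈ s.F.support, s.r ≤ d) {i₀ : σ} (hri₀ : s.r i₀ = 0) {d₀ : σ →₀ ℕ}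
    (hd₀ : d₀ ∈ s.F.support) (hd₀deg : d₀.degree = o) (hd₀i : ¬ p ^ e ∣ d₀ i₀) :
    ¬ ShadeIncreases (p ^ e) j b s :=
  not_lt.mpr (shade_step_le_of_pow_witness p j b hbj s ho hqo hr hri₀ hd₀ hd₀deg hd₀i)

/-- **Necessary condition for an increase at order `pᵉ`, non-exceptional variables included**
(strengthening `necessary_of_shadeIncreases_pow` (ii), which covers the indices `i ≠ j`): if the
shade increases at a point of the `y_j`-chart, then EVERY non-exceptional variable `y_i`
(`r_i = 0`) — the chart variable `y_j` included — occurs in the initial form of `F` only with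
exponents divisible by `q`. [cite: HauserPerlega2019PRIMS, §3 Theorem (7)]
[cite: Moh1987, §1 (p. 972)] -/
theorem pow_dvd_apply_of_shadeIncreases_of_nonexceptional {e : ℕ} (j : σ) (b : σ → K)
    (hbj : b j = 0) (s : State σ K) {o : ℕ} (ho : ordZero s.F = o) (hqo : p ^ e ≤ o)
    (hr : ∀ d ∈ s.F.support, s.r ≤ d) (hinc : ShadeIncreases (p ^ e) j b s)
    {i : σ} (hri : s.r i = 0) {d : σ →₀ ℕ} (hd : d ∈ s.F.support) (hddeg : d.degree = o) :
    p ^ e ∣ d i := by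
  by_contra hndvd
  exact not_shadeIncreases_of_pow_witness p j b hbj s ho hqo hr hri hd hddeg hndvd hinc

/-! ## 5. Persistence of the witness under a stall; no increase before a drop -/

/-- **Persistence of a `q`-witness under a stall, every `e`, every dimension.** In the situation
of `shade_step_le_of_pow_witness`, if the shade of the new state EQUALS the old one (a stall, at
any point of any chart), the new state again has a `q`-witness: a variable `y_{i₁}` with
`r′_{i₁} = 0` occurring in an INITIAL monomial of `F′` with an exponent not divisible by `q`. In a
chart `j ≠ i₀` it is `y_{i₀}` itself (the gen-14 Hasse probe `exists_support_step_of_choose_ne_zero'`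
produces a monomial with `q ∤ E_{i₀}` of degree `≤ |r′| + shade`, initial in a stall); in the
chart `j = i₀` a translated variable `y_i`, `b_i ≠ 0` (the strict-drop alternative of
`exists_support_step_of_not_pow_dvd_self'` being excluded by the stall). The `e = 1` instance is
`exists_witness_step_of_shade_eq`; Moh's printed precursor: after the jump "`x_s` is an `X`-kind
of variable … Repeating the above argument" ([Moh87] pp. 972–973). Derived here for every `e`.
[cite: Moh1987, §1 (pp. 972–973)] -/
theorem exists_pow_witness_step_of_shade_eq {e : ℕ} (j : σ) (b : σ → K) (hbj : b j = 0)
    (s : State σ K) {o : ℕ} (ho : ordZero s.F = o) (hqo : p ^ e ≤ o)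
    (hr : ∀ d ∈ s.F.support, s.r ≤ d) {i₀ : σ} (hri₀ : s.r i₀ = 0) {d₀ : σ →₀ ℕ}
    (hd₀ : d₀ ∈ s.F.support) (hd₀deg : d₀.degree = o) (hd₀i : ¬ p ^ e ∣ d₀ i₀)
    (hstall : (step (p ^ e) j b s).shade = s.shade) :
    ∃ (i₁ : σ) (o₁ : ℕ) (E : σ →₀ ℕ), ordZero (step (p ^ e) j b s).F = o₁ ∧
      E ∈ (step (p ^ e) j b s).F.support ∧ E.degree = o₁ ∧ ¬ p ^ e ∣ E i₁ ∧
      (step (p ^ e) j b s).r i₁ = 0 := by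
  have hr1 := newMult_le_of_mem_support_step (p ^ e) j b hbj s ho hr
  have hshade1 : (step (p ^ e) j b s).shade = ((o - s.r.degree : ℕ) : ℕ∞) := by
    rw [hstall, shade_eq_of_ordZero_eq s ho]
  -- a natural-number order for the new state (it has a monomial by the probes)
  have hord1 : ∀ {E : σ →₀ ℕ}, E ∈ (step (p ^ e) j b s).F.support →
      ∃ o₁ : ℕ, ordZero (step (p ^ e) j b s).F = o₁ := by
    intro E hE
    have hF1 : (step (p ^ e) j b s).F ≠ 0 := fun h => by
      rw [h, MvPolynomial.support_zero] at hE; exact Finset.notMem_empty _ hE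
    have hne : ordZero (step (p ^ e) j b s).F ≠ ⊤ := by
      unfold ordZero
      rw [Ne, MvPowerSeries.order_eq_top_iff, MvPolynomial.coe_eq_zero_iff]
      exact hF1
    obtain ⟨o₁, ho₁'⟩ := WithTop.ne_top_iff_exists.mp hne
    exact ⟨o₁, ho₁'.symm⟩
  by_cases h : i₀ = j
  · subst h
    obtain ⟨E, hE, -, hcases⟩ :=
      exists_support_step_of_not_pow_dvd_self' p i₀ b hbj s ho hqo hr hri₀ hd₀ hd₀deg hd₀i
    obtain ⟨o₁, ho₁⟩ := hord1 hE
    rcases hcases with hlt | ⟨hle, i, hij, hbi, hEi⟩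
    · -- a strict drop contradicts the stall
      exfalso
      have h1 := degree_eq_of_shade_eq (step (p ^ e) i₀ b s) ho₁ hr1 hE (A := o - s.r.degree)
        (by omega) hshade1
      obtain ⟨⟨E₁, hE₁, hE₁deg⟩, -⟩ := (ordZero_eq_nat_iff _ _).mp ho₁
      have h2 : (step (p ^ e) i₀ b s).r.degree ≤ o₁ :=
        hE₁deg ▸ degree_le_degree_of_le (hr1 E₁ (MvPolynomial.mem_support_iff.mpr hE₁))
      rw [shade_eq_of_ordZero_eq _ ho₁] at hshade1
      have h3 : o₁ - (step (p ^ e) i₀ b s).r.degree = o - s.r.degree := by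
        exact_mod_cast hshade1
      omega
    · refine ⟨i, o₁, E, ho₁, hE, ?_, hEi, ?_⟩
      · exact degree_eq_of_shade_eq (step (p ^ e) i₀ b s) ho₁ hr1 hE hle hshade1
      · show newMult (p ^ e) i₀ b s i = 0
        rw [newMult_eq (p ^ e) i₀ b hbj s ho, Finsupp.filter_apply, if_neg hbi]
  · obtain ⟨k, hk, hck⟩ := exists_natCast_choose_prime_pow_ne_zero p K hd₀i
    obtain ⟨E, hE, hEi₀, -, hEdeg⟩ :=
      exists_support_step_of_choose_ne_zero' p j b hbj s ho hqo hr h hk hd₀ hd₀deg hck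
    have had₀ : p ^ k ≤ d₀ i₀ := by
      by_contra hlt
      exact hck (by rw [Nat.choose_eq_zero_of_lt (not_le.mp hlt), Nat.cast_zero])
    have hro : s.r.degree + p ^ k ≤ o := by
      have h1 := degree_eq_add_sum_erase i₀ s.r
      have h2 := degree_eq_add_sum_erase i₀ d₀
      have h3 : ∑ i ∈ univ.erase i₀, s.r i ≤ ∑ i ∈ univ.erase i₀, d₀ i :=
        Finset.sum_le_sum fun i _ => Finsupp.le_def.mp (hr d₀ hd₀) i
      omega
    rw [hasseProbe_bound_of_apply_eq_zero j b hbj s ho hri₀ hro] at hEdeg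
    obtain ⟨o₁, ho₁⟩ := hord1 hE
    refine ⟨i₀, o₁, E, ho₁, hE, ?_, hEi₀, ?_⟩
    · exact degree_eq_of_shade_eq (step (p ^ e) j b s) ho₁ hr1 hE hEdeg hshade1
    · show newMult (p ^ e) j b s i₀ = 0
      rw [newMult_eq (p ^ e) j b hbj s ho, Finsupp.filter_apply, Finsupp.update_apply, if_neg h,
        hri₀]
      split_ifs <;> rfl

/-- **From a state with a `q`-witness the shade does not increase before it drops** (every `e`,
every dimension). Along any sequence of point blow-ups `s (n+1) = step q (j n) (b n) (s n)`
(`q = pᵉ`, points `b n` on the new exceptional divisor, order `≥ q` throughout) starting from a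
state whose residual polynomial is divisible by its exceptional monomial and which carries a
`q`-witness: if the shade has not dropped during the first `n` steps, then it has not changed, the
`n`-th state again carries a `q`-witness, and its residual polynomial is divisible by its
exceptional monomial. (No cleanness hypothesis: the probes produce surviving monomials directly.)
The `e = 1` instance is the invariant behind `shade_le_shade_add_one_along` (Moh's Stability
Theorem at order `p`); at `e ≥ 2` the witness need not be created by a jump (it is when the
post-jump order is divisible by `q`, `exists_initial_lowestLayer_of_pow_dvd`), which is where the
analogy with `e = 1` stops. [cite: Moh1987, §1 (pp. 972–973)] -/
theorem shade_eq_and_pow_witness_of_not_drop {e : ℕ} (s : ℕ → State σ K) (j : ℕ → σ)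
    (b : ℕ → σ → K) (hb : ∀ n, b n (j n) = 0)
    (hstep : ∀ n, s (n + 1) = step (p ^ e) (j n) (b n) (s n))
    (hr : ∀ d ∈ (s 0).F.support, (s 0).r ≤ d)
    (hord : ∀ n, ((p ^ e : ℕ) : ℕ∞) ≤ ordZero (s n).F)
    (hwit : ∃ (i₀ : σ) (o₀ : ℕ) (d₀ : σ →₀ ℕ), ordZero (s 0).F = o₀ ∧ d₀ ∈ (s 0).F.support ∧
      d₀.degree = o₀ ∧ ¬ p ^ e ∣ d₀ i₀ ∧ (s 0).r i₀ = 0)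
    (n : ℕ) (hmono : ∀ m < n, (s m).shade ≤ (s (m + 1)).shade) :
    (s n).shade = (s 0).shade ∧ (∀ d ∈ (s n).F.support, (s n).r ≤ d) ∧
      ∃ (i : σ) (o : ℕ) (d : σ →₀ ℕ), ordZero (s n).F = o ∧ d ∈ (s n).F.support ∧
        d.degree = o ∧ ¬ p ^ e ∣ d i ∧ (s n).r i = 0 := by
  induction n with
  | zero => exact ⟨rfl, hr, hwit⟩
  | succ n ih =>
    obtain ⟨hsh, hrn, i, o, d, ho, hd, hddeg, hdi, hri⟩ :=
      ih fun m hm => hmono m (Nat.lt_succ_of_lt hm)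
    have hqo : p ^ e ≤ o := by
      have := hord n
      rw [ho] at this
      exact_mod_cast this
    have hle : (s (n + 1)).shade ≤ (s n).shade := by
      rw [hstep n]
      exact shade_step_le_of_pow_witness p (j n) (b n) (hb n) (s n) ho hqo hrn hri hd hddeg hdi
    have hstall : (s (n + 1)).shade = (s n).shade :=
      le_antisymm hle (hmono n (Nat.lt_succ_self n))
    refine ⟨hstall.trans hsh, ?_, ?_⟩
    · rw [hstep n]
      exact newMult_le_of_mem_support_step (p ^ e) (j n) (b n) (hb n) (s n) ho hrn
    · rw [hstep n] at hstall ⊢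
      obtain ⟨i₁, o₁, E, ho₁, hE, hEdeg, hEi, hri₁⟩ := exists_pow_witness_step_of_shade_eq p
        (j n) (b n) (hb n) (s n) ho hqo hrn hri hd hddeg hdi hstall
      exact ⟨i₁, o₁, E, ho₁, hE, hEdeg, hEi, hri₁⟩

/-- **A `q`-witness: every later excess over the initial shade is preceded by a drop.** In the
situation of `shade_eq_and_pow_witness_of_not_drop`, if `shade(s n) > shade(s 0)` then the shade
dropped strictly at some earlier step. [cite: Moh1987, §1 (pp. 972–973)] -/
theorem exists_drop_of_shade_lt_of_pow_witness {e : ℕ} (s : ℕ → State σ K) (j : ℕ → σ)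
    (b : ℕ → σ → K) (hb : ∀ n, b n (j n) = 0)
    (hstep : ∀ n, s (n + 1) = step (p ^ e) (j n) (b n) (s n))
    (hr : ∀ d ∈ (s 0).F.support, (s 0).r ≤ d)
    (hord : ∀ n, ((p ^ e : ℕ) : ℕ∞) ≤ ordZero (s n).F)
    (hwit : ∃ (i₀ : σ) (o₀ : ℕ) (d₀ : σ →₀ ℕ), ordZero (s 0).F = o₀ ∧ d₀ ∈ (s 0).F.support ∧
      d₀.degree = o₀ ∧ ¬ p ^ e ∣ d₀ i₀ ∧ (s 0).r i₀ = 0)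
    (n : ℕ) (hn : (s 0).shade < (s n).shade) :
    ∃ m < n, (s (m + 1)).shade < (s m).shade := by
  by_contra hc
  push Not at hc
  have h := (shade_eq_and_pow_witness_of_not_drop p s j b hb hstep hr hord hwit n hc).1
  rw [h] at hn
  exact lt_irrefl _ hn

/-- **After a jump onto an order divisible by `q`, the shade does not increase again before it
has dropped** (every `e`, every dimension). Along a sequence of point blow-ups at order `q = pᵉ`
as above, suppose the shade increases at step `n` from a cleaned state whose residual polynomial
is divisible by its exceptional monomial, and the new order `ord₀ F_{n+1}` is divisible by `q`.
Then the new state carries a `q`-witness (`exists_initial_lowestLayer_of_pow_dvd`: a lost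
exceptional component with Moh's term `A`), so every later excess over `shade(s (n+1))` is
preceded by a strict drop — the pattern "increase, stalls, increase" is impossible in this case.
(When `q ∤ ord₀ F_{n+1}` only the NEXT step is controlled: `not_shadeIncreases_step_of_shadeIncreases_pow`.)
This is the part of Moh's "successive permissible blow-ups will not increase `ord F̄` beyond the
bound … until it drops" ([Moh87] p. 966) that survives at every `e`; the full claim is false for
`e ≥ 3` (`mohStabilityClaim_false`) and open in print for `e = 2`.
[cite: Moh1987, Stability Theorem (Introduction) and §1 (pp. 972–973)] -/
theorem exists_drop_of_shade_lt_after_jump_of_pow_dvd {e : ℕ} (s : ℕ → State σ K) (j : ℕ → σ)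
    (b : ℕ → σ → K) (hb : ∀ n, b n (j n) = 0)
    (hstep : ∀ n, s (n + 1) = step (p ^ e) (j n) (b n) (s n))
    (hord : ∀ n, ((p ^ e : ℕ) : ℕ∞) ≤ ordZero (s n).F) (n : ℕ)
    (hclean : deletePthPowers (p ^ e) (s n).F = (s n).F) {o : ℕ} (ho : ordZero (s n).F = o)
    (hr : ∀ d ∈ (s n).F.support, (s n).r ≤ d) (hinc : (s n).shade < (s (n + 1)).shade)
    {o₁ : ℕ} (ho₁ : ordZero (s (n + 1)).F = o₁) (hdvd : p ^ e ∣ o₁)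
    (m : ℕ) (hm : (s (n + 1)).shade < (s (n + 1 + m)).shade) :
    ∃ l < m, (s (n + 1 + l + 1)).shade < (s (n + 1 + l)).shade := by
  have hqo : p ^ e ≤ o := by
    have := hord n
    rw [ho] at this
    exact_mod_cast this
  have hinc' : ShadeIncreases (p ^ e) (j n) (b n) (s n) := by
    unfold ShadeIncreases
    rw [← hstep n]
    exact hinc
  have ho₁' : ordZero (step (p ^ e) (j n) (b n) (s n)).F = o₁ := by rw [← hstep n]; exact ho₁
  obtain ⟨i₀, -, -, -, hri₀, E, hE, hEdeg, -, hEi₀, -⟩ :=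
    exists_initial_lowestLayer_of_pow_dvd p (j n) (b n) (hb n) (s n) hclean ho hqo hr hinc' ho₁' hdvd
  have hr1 : ∀ d ∈ (s (n + 1)).F.support, (s (n + 1)).r ≤ d := by
    rw [hstep n]
    exact newMult_le_of_mem_support_step (p ^ e) (j n) (b n) (hb n) (s n) ho hr
  have hwit : ∃ (i : σ) (o' : ℕ) (d : σ →₀ ℕ), ordZero (s (n + 1)).F = o' ∧
      d ∈ (s (n + 1)).F.support ∧ d.degree = o' ∧ ¬ p ^ e ∣ d i ∧ (s (n + 1)).r i = 0 := by
    refine ⟨i₀, o₁, E, ho₁, ?_, hEdeg, hEi₀, ?_⟩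
    · rw [hstep n]; exact hE
    · rw [hstep n]; exact hri₀
  exact exists_drop_of_shade_lt_of_pow_witness p (fun k => s (n + 1 + k)) (fun k => j (n + 1 + k))
    (fun k => b (n + 1 + k)) (fun k => hb _) (fun k => hstep (n + 1 + k)) hr1
    (fun k => hord _) hwit m hm

end Main

end PointBlowup

end Literature.AlgebraicGeometry.Resolution
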